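import Summits.NavierStokesRegularity.NavierStokesRegularity.Theses.AxisymmetricExtremality
import Summits.NavierStokesRegularity.NavierStokesRegularity.Theorems.AxisymmetricExtremalityPFoldToAxisymmetric
import Summits.NavierStokesRegularity.NavierStokesRegularity.Theorems.AxisymmetricExtremalityAxisymmetricKatoGlobalNoSwirlStratum
import Summits.NavierStokesRegularity.NavierStokesRegularity.Theorems.AxisymmetricExtremalityAxisymmetricKatoGlobalReduction
import Summits.NavierStokesRegularity.NavierStokesRegularity.Theorems.AxisymmetricExtremalityAxisymmetricKatoGlobalStubSereginLogSwirlOrigin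
import Literature.Analysis.FluidPDE.AxisymmetricReflection
import HarnessLib

/-!
# Strategist s18-g2 (independent census, family `s`) — crux `AxisymmetricKatoGlobal`
(item stmt-NavierStokesRegularity-15453, route `AxisymmetricExtremality`)

Kernel-checked typing of the census `STRATEGY-CENSUS-s18-g2.md`:

* §1 WEAKER INTERMEDIATE FROM THE SUMMIT.  The deciding theorem `closes` consumes only the
  THRESHOLD INSTANCE `NoAxisymMinimalDatum` (W0) of the crux (`noAxisymMinimalDatum_of_AXH`,
  `navierStokesRegularity_of_noAxisymMinimalDatum`).  The O(2)-instance of W0 — no axisymmetric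
  minimal blow-up datum which is ALSO equivariant under the meridian reflection `reflY` — is
  PROVED here (`noO2MinimalDatum`) from the landed swirl-free stratum
  `axisymmetricKatoGlobal_noSwirl_stratum` and `IsAxisymmetric.hasNoSwirl_of_reflY_eq`.
  Hence the route's own lever (Smith fixed points on `M̂ = M/Sim`) run with the 2-GROUPS
  `D_{2^k} ⊂ O(2)` instead of `ℤ/p` BYPASSES the crux: `closes_bypass :
  MinimalDatumDihedral → DihedralToO2 → NavierStokesRegularity` (pure logic + proved tree facts),
  where `MinimalDatumDihedral` is crux #2 re-run for dihedral 2-groups and `DihedralToO2` is the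
  proved compactness upgrade `PFoldToAxisymmetric` with one more (reflection) clause.
  `minimalDatumPFold_of_dihedral` records that #2′ ⇒ #2.
* §3 DECOMPOSITION.  The best typed split of the crux AS TYPED: the rate-free dichotomy at the
  axis, `SwirlVanishesAtAxis` (B: the swirl `Γ = r u_θ` of an axisymmetric Kato solution tends
  to 0 at the axis uniformly up to the final time) and `VanishingSwirlUpgrade` (A: a uniform
  `o(1)` modulus upgrades to Seregin's `C/|log r|³`), with the assembly
  `axisymmetricKatoGlobal_of_split : VanishingSwirlUpgrade → SwirlVanishesAtAxis →
  AxisymmetricKatoGlobal` PROVED from the landed reduction `AxisymmetricKatoGlobal_of_logSwirlFacts`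
  and the discharged criterion `seregin2022_logSwirl_regularAtOrigin_holds`.  Not filed as a
  route split: piece B carries the whole Type-II/tornado difficulty (census §3).
-/

noncomputable section

set_option linter.dupNamespace false

open Set Function MeasureTheory Filter Topology
open scoped ENNReal
open Literature.Analysis.FluidPDE Literature.Analysis.FunctionSpaces
open Summit.NavierStokesRegularity.NavierStokesRegularity.Theses.AxisymmetricExtremality
open Summit.NavierStokesRegularity.NavierStokesRegularity.Theorems
open Summit.NavierStokesRegularity.NavierStokesRegularity.Theorems.AxisymmetricKatoGlobal.NoSwirlStratum
open Summit.NavierStokesRegularity.NavierStokesRegularity.Theorems.AxisymmetricKatoGlobal.Registered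
open Summit.NavierStokesRegularity.NavierStokesRegularity.Theorems.AxisymmetricKatoGlobal.EulerScaling

namespace Summit.NavierStokesRegularity.NavierStokesRegularity.Cruxes.AxisymmetricKatoGlobal.StrategistS18g2

local notation "ℝ³" => EuclideanSpace ℝ (Fin 3)

/-- The critical space `Ḣ^{1/2}(ℝ³; ℂ³)` of the route file. -/
abbrev H12 : Type := HomSobolev (EuclideanSpace ℝ (Fin 3)) (EuclideanSpace ℂ (Fin 3)) (1 / 2 : ℝ)

/-! ## §1  The weaker intermediate consumed by `closes`, and the 2-group bypass -/

/-- CLAY FAILURE at viscosity `ν`: the antecedent of crux #2 `MinimalDatumPFold`, verbatim — some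
Clay datum (smooth, divergence-free, rapidly decaying) has no jointly smooth bounded-energy global
solution. -/
def ClayFailure (ν : ℝ) : Prop :=
  ∃ v₀ : ℝ³ → ℝ³, ContDiff ℝ (⊤ : ℕ∞) v₀ ∧ NSWave0.IsDivFree v₀ ∧ HasRapidSpatialDecay v₀ ∧
    ¬ ∃ (u : ℝ → ℝ³ → ℝ³) (p : ℝ → ℝ³ → ℝ), IsSmoothOnHalfSpace u ∧ IsSmoothOnHalfSpace p ∧
      IsNavierStokesSolution ν 0 v₀ u p ∧ HasBoundedEnergy u

/-- **W0** — the THRESHOLD INSTANCE of the crux, the only thing `closes` consumes: for every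
`ν > 0` there is no axisymmetric Rusin–Šverák minimal blow-up datum. -/
def NoAxisymMinimalDatum : Prop :=
  ∀ ν : ℝ, 0 < ν → ∀ (u₀ : ℝ³ → ℝ³) (g : H12), IsMinimalBlowupDatum ν u₀ g → IsAxisymmetric u₀ → False

/-- AX_H ⇒ W0 (one line: the minimality clause `¬ HasGlobalKatoSolution`). -/
theorem noAxisymMinimalDatum_of_AXH (h : AxisymmetricKatoGlobal) : NoAxisymMinimalDatum := by
  intro ν hν u₀ g hmin hax
  obtain ⟨hL3, hrep, hdiv, -, hnot⟩ := hmin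
  exact hnot (h ν hν u₀ g hL3 hrep hdiv (fun θ x => hax θ x))

/-- W0 suffices for the route: `MinimalDatumPFold → W0 → NavierStokesRegularity`, by the PROVED
crux `PFoldToAxisymmetric` (`axisymmetricExtremality_pFoldToAxisymmetric_proof`) and the same three
lines of logic as `closes`. -/
theorem navierStokesRegularity_of_noAxisymMinimalDatum (h₂ : MinimalDatumPFold)
    (h₀ : NoAxisymMinimalDatum) : NavierStokesRegularity := by
  show Literature.NS.NavierStokesExistenceSmoothR3
  intro ν hν u₀ hsm hdiv hdec
  by_contra hno
  obtain ⟨u₁, g, hmin, hax⟩ :=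
    axisymmetricExtremality_pFoldToAxisymmetric_proof ν hν (h₂ ν hν ⟨u₀, hsm, hdiv, hdec, hno⟩)
  exact h₀ ν hν u₁ g hmin (fun θ x => hax θ x)

/-- **The swirl-free instance of W0 is PROVED**: no axisymmetric swirl-free minimal blow-up datum
(landed `axisymmetricKatoGlobal_noSwirl_stratum`, any `ν > 0`). -/
theorem noSwirlFreeAxisymMinimalDatum :
    ∀ ν : ℝ, 0 < ν → ∀ (u₀ : ℝ³ → ℝ³) (g : H12),
      IsMinimalBlowupDatum ν u₀ g → IsAxisymmetric u₀ → HasNoSwirl u₀ → False := by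
  intro ν hν u₀ g hmin hax hsw
  obtain ⟨hL3, -, hdiv, -, hnot⟩ := hmin
  exact hnot (axisymmetricKatoGlobal_noSwirl_stratum ν hν u₀ hL3 hdiv (fun θ x => hax θ x) hsw)

/-- **The O(2)-instance of W0 is PROVED**: no minimal blow-up datum equivariant under the full
group `O(2) = SO(2) ⋊ ⟨σ⟩` of the axis (`σ = reflY`, the meridian reflection
`(x₀, x₁, x₂) ↦ (x₀, −x₁, x₂)`): axisymmetric + `σ`-equivariant ⇒ swirl-free
(`IsAxisymmetric.hasNoSwirl_of_reflY_eq`, Majda–Bertozzi §2.3.3). -/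
theorem noO2MinimalDatum :
    ∀ ν : ℝ, 0 < ν → ∀ (u₀ : ℝ³ → ℝ³) (g : H12),
      IsMinimalBlowupDatum ν u₀ g → IsAxisymmetric u₀ → (∀ x, u₀ (reflY x) = reflY (u₀ x)) →
        False :=
  fun ν hν u₀ g hmin hax hσ =>
    noSwirlFreeAxisymMinimalDatum ν hν u₀ g hmin hax (hax.hasNoSwirl_of_reflY_eq hσ)

/-- **Crux #2′ `MinimalDatumDihedral`** (the route's Smith lever run with 2-GROUPS): Clay failure at
`ν` ⇒ for every `k` there is a minimal blow-up datum equivariant under the DIHEDRAL 2-group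
`D_{2^k}` generated by the rotation `R_{2π/2^k}` about the `x₂`-axis and the meridian reflection
`σ = reflY`.  Source of the claim: `M̂ = M/Sim` compact (Rusin–Šverák 2011 Cor. 4.3), `O(3)` acts;
IF `M̂` is `𝔽₂`-acyclic, P. A. Smith's theorem for finite 2-groups (Allday–Puppe 1993 (1.4.7),
Cor. 3.1.13; Bredon 1972 III.7.11) gives `M̂^{D_{2^k}} ≠ ∅` for every `k` — ONE prime (2) suffices,
where `MinimalDatumPFold` needs fixed points for infinitely many group orders.  Why it might fail:
exactly as #2 — no `𝔽₂`-acyclicity of `M̂` is known (M̂ may be a finite union of orbits). -/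
def MinimalDatumDihedral : Prop :=
  ∀ ν : ℝ, 0 < ν → ClayFailure ν → ∀ k : ℕ, ∃ (u₀ : ℝ³ → ℝ³) (g : H12),
    IsMinimalBlowupDatum ν u₀ g ∧
      (∀ x, u₀ (rotZ (2 * Real.pi / ((2 ^ k : ℕ) : ℝ)) x) =
        rotZ (2 * Real.pi / ((2 ^ k : ℕ) : ℝ)) (u₀ x)) ∧
      (∀ x, u₀ (reflY x) = reflY (u₀ x))

/-- **`DihedralToO2`** — the compactness upgrade `PFoldToAxisymmetric` (PROVED, four landed stubs
`stub_compactModuloSim`, `stub_axisPinning`, `stub_denseAngleClosure`, `stub_aeAxisymmetricUpgrade`)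
with ONE more clause carried through the limit: `D_{2^k}`-equivariant minimal data for all `k`
⇒ an `O(2)`-equivariant (axisymmetric AND `σ`-equivariant) minimal blow-up datum.  New work only:
the reflection planes (angles in the compact circle) converge along a subsequence, a.e.
`σ_α`-equivariance passes to the `L³` limit, conjugate by `R_{−α}`, and average over the compact
group `O(2)` instead of `SO(2)` in the a.e. → everywhere upgrade. [difficulty: M, provable now] -/
def DihedralToO2 : Prop :=
  ∀ ν : ℝ, 0 < ν →
    (∀ k : ℕ, ∃ (u₀ : ℝ³ → ℝ³) (g : H12), IsMinimalBlowupDatum ν u₀ g ∧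
      (∀ x, u₀ (rotZ (2 * Real.pi / ((2 ^ k : ℕ) : ℝ)) x) =
        rotZ (2 * Real.pi / ((2 ^ k : ℕ) : ℝ)) (u₀ x)) ∧
      (∀ x, u₀ (reflY x) = reflY (u₀ x))) →
    ∃ (u₀ : ℝ³ → ℝ³) (g : H12), IsMinimalBlowupDatum ν u₀ g ∧ IsAxisymmetric u₀ ∧
      ∀ x, u₀ (reflY x) = reflY (u₀ x)

/-- #2′ ⇒ #2: dihedral `2^k`-fold data are in particular `p`-fold for unboundedly many `p = 2^k`
(so `MinimalDatumDihedral` is a strengthening of the filed crux `MinimalDatumPFold`, not a new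
antecedent). -/
theorem minimalDatumPFold_of_dihedral (h : MinimalDatumDihedral) : MinimalDatumPFold := by
  intro ν hν hclay N
  have hN : ∀ m : ℕ, m ≤ 2 ^ m := by
    intro m
    induction m with
    | zero => simp
    | succ n ih =>
      have h1 : 1 ≤ 2 ^ n := Nat.one_le_two_pow
      rw [pow_succ]; omega
  have hN' := hN N
  have h1 : 1 ≤ 2 ^ N := Nat.one_le_two_pow
  obtain ⟨u₀, g, hmin, hrot, -⟩ := h ν hν hclay (N + 1)
  refine ⟨2 ^ (N + 1), ?_, ?_, u₀, g, hmin, fun x => hrot x⟩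
  · rw [pow_succ]; omega
  · rw [pow_succ]; omega

/-- **THE BYPASS, kernel-checked**: `MinimalDatumDihedral → DihedralToO2 → NavierStokesRegularity`
— pure logic on the Clay conclusion plus the PROVED `noO2MinimalDatum`; the crux
`AxisymmetricKatoGlobal` (axisymmetric-with-swirl regularity, open since 1968) is not used. -/
theorem closes_bypass (h₂ : MinimalDatumDihedral) (h₅ : DihedralToO2) : NavierStokesRegularity := by
  show Literature.NS.NavierStokesExistenceSmoothR3
  intro ν hν u₀ hsm hdiv hdec
  by_contra hno
  obtain ⟨u₁, g, hmin, hax, hσ⟩ := h₅ ν hν (h₂ ν hν ⟨u₀, hsm, hdiv, hdec, hno⟩)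
  exact noO2MinimalDatum ν hν u₁ g hmin hax hσ

/-! ## §3  The best typed split of the crux AS TYPED (rate-free dichotomy at the axis) -/

/-- Piece **B** `SwirlVanishesAtAxis`: along every axisymmetric Kato solution smooth on the open
strip `(0,T)`, the swirl `Γ = r u_θ` tends to `0` at the axis UNIFORMLY up to the final time (a
rate-free modulus).  OPEN: excludes Hou's tornado scenario (persistent `Γ ≍ 1` on a collapsing
ring); nothing in print. -/
def SwirlVanishesAtAxis : Prop :=
  ∀ ν : ℝ, 0 < ν → ∀ T : ℝ, 0 < T → ∀ (u₀ : ℝ³ → ℝ³) (g : H12) (u : ℝ → ℝ³ → ℝ³),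
    g.Represents (Literature.Analysis.FunctionSpaces.EuclideanSpace.complexify ∘ u₀) →
    IsKatoSolutionOn T ν u₀ u → ContDiffOn ℝ (⊤ : ℕ∞) (uncurry u) (Ioo 0 T ×ˢ univ) →
    (∀ t ∈ Ioo 0 T, IsAxisymmetric (u t)) →
    ∀ t₀ ∈ Ioo 0 T, ∀ ε : ℝ, 0 < ε → ∃ δ : ℝ, 0 < δ ∧
      ∀ t ∈ Ico t₀ T, ∀ x : ℝ³, cylRadius x ≤ δ → |swirl (u t) x| ≤ ε

/-- Piece **A** `VanishingSwirlUpgrade`: a uniform rate-free modulus of `Γ` at the axis up to the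
final time upgrades to Seregin's logarithmic modulus `|Γ| ≤ C/|log r|³`.  OPEN (the review
Zhang–Pan–Zhang 2022 §2, p. 9: "It would be interesting if one can lower the power on |ln r| even
further … the drift term … is the main obstacle"; known only with smallness RELATIVE to critical
norms, Liu–Zhang 2017 Thm 1.2). -/
def VanishingSwirlUpgrade : Prop :=
  ∀ ν : ℝ, 0 < ν → ∀ T : ℝ, 0 < T → ∀ (u₀ : ℝ³ → ℝ³) (g : H12) (u : ℝ → ℝ³ → ℝ³),
    g.Represents (Literature.Analysis.FunctionSpaces.EuclideanSpace.complexify ∘ u₀) →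
    IsKatoSolutionOn T ν u₀ u → ContDiffOn ℝ (⊤ : ℕ∞) (uncurry u) (Ioo 0 T ×ˢ univ) →
    (∀ t ∈ Ioo 0 T, IsAxisymmetric (u t)) →
    ∀ t₀ ∈ Ioo 0 T,
      (∀ ε : ℝ, 0 < ε → ∃ δ : ℝ, 0 < δ ∧
        ∀ t ∈ Ico t₀ T, ∀ x : ℝ³, cylRadius x ≤ δ → |swirl (u t) x| ≤ ε) →
      ∃ C δ₀ : ℝ, 0 < δ₀ ∧ δ₀ < 1 ∧
        ∀ t ∈ Ico t₀ T, ∀ x : ℝ³, cylRadius x ≤ δ₀ → |swirl (u t) x| ≤ C / |Real.log (cylRadius x)| ^ 3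

/-- **Assembly of the split, PROVED**: `A → B → AxisymmetricKatoGlobal`, through the landed
reduction `AxisymmetricKatoGlobal_of_logSwirlFacts` (all bookkeeping stubs of line `registered`
landed) and the DISCHARGED local criterion `seregin2022_logSwirl_regularAtOrigin_holds`. -/
theorem axisymmetricKatoGlobal_of_split (hA : VanishingSwirlUpgrade) (hB : SwirlVanishesAtAxis) :
    AxisymmetricKatoGlobal := by
  refine AxisymmetricKatoGlobal_of_logSwirlFacts seregin2022_logSwirl_regularAtOrigin_holds ?_
  intro ν hν T hT u₀ g u hrep hK hsm hax t₀ ht₀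
  exact hA ν hν T hT u₀ g u hrep hK hsm hax t₀ ht₀ (hB ν hν T hT u₀ g u hrep hK hsm hax t₀ ht₀)

end Summit.NavierStokesRegularity.NavierStokesRegularity.Cruxes.AxisymmetricKatoGlobal.StrategistS18g2

end
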